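import Summits.Ventures.PercRepro2.CaseOneTwoMarkMass

/-!
# The marked star: `a₃` adjacent exactly to `a₁`, `a₂`, `o`, `b` — pointwise structure
(blind cell PercRepro2, p1 g15; S5 §2.1 (K9) (p), proofs/P1-TWOMARK.md §4–§5)

`IsMarkedStarAt`: the four edges `e₁ = {a₁, a₃}`, `e₂ = {a₂, a₃}`, `eo = {o, a₃}`, `eb = {b, a₃}` are
all the edges at `a₃`. With all four closed `a₃` is isolated (`base4`); opening a subset of them,
**`a₃` bridges its open neighbours**: for `x, y ≠ a₃`, `x ↔ y` iff `x ↔ y` in the base or `x ↔ u` and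
`v ↔ y` in the base for open neighbours `u, v` (`conn_open4_iff`), and `x ↔ a₃` iff `x ↔ u` in the base
for an open neighbour `u` (`conn_open4_a3_iff`) — proved by the one-edge step `bridge_step` applied
four times. The quadruple pinning `expect_fourPin` / `prob_fourPin` (sixteen terms) is in
`CaseOneStarPin.lean`. -/

namespace Summit.Ventures.PercRepro2

namespace CaseOne

section Star
variable {V : Type*} {E : Type*} [DecidableEq E]

/-- **The marked star**: `a₃`'s edges are exactly `e₁ = {a₁, a₃}`, `e₂ = {a₂, a₃}`, `eo = {o, a₃}`,
`eb = {b, a₃}` (four distinct edges), with `a₁, a₂, o, b ≠ a₃`. -/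
structure IsMarkedStarAt (ends : E → Sym2 V) (o a₁ a₂ b a₃ : V) (e₁ e₂ eo eb : E) : Prop where
  /-- the edge to `a₁` -/
  ends_1 : ends e₁ = s(a₁, a₃)
  /-- the edge to `a₂` -/
  ends_2 : ends e₂ = s(a₂, a₃)
  /-- the edge to `o` -/
  ends_o : ends eo = s(o, a₃)
  /-- the edge to `b` -/
  ends_b : ends eb = s(b, a₃)
  /-- distinct edges -/
  ne_12 : e₁ ≠ e₂
  /-- distinct edges -/
  ne_1o : e₁ ≠ eo
  /-- distinct edges -/
  ne_1b : e₁ ≠ eb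
  /-- distinct edges -/
  ne_2o : e₂ ≠ eo
  /-- distinct edges -/
  ne_2b : e₂ ≠ eb
  /-- distinct edges -/
  ne_ob : eo ≠ eb
  /-- no other edge at `a₃` -/
  unique : ∀ e, a₃ ∈ ends e → e = e₁ ∨ e = e₂ ∨ e = eo ∨ e = eb
  /-- `a₁ ≠ a₃` -/
  ne_a1 : a₁ ≠ a₃
  /-- `a₂ ≠ a₃` -/
  ne_a2 : a₂ ≠ a₃
  /-- `o ≠ a₃` -/
  ne_o : o ≠ a₃
  /-- `b ≠ a₃` -/
  ne_b : b ≠ a₃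

variable {ends : E → Sym2 V} {o a₁ a₂ b a₃ : V} {e₁ e₂ eo eb : E}

/-- The configuration with the four edges at `a₃` closed. -/
def base4 (e₁ e₂ eo eb : E) (ω : Config E) : Config E :=
  Function.update (Function.update (Function.update (Function.update ω e₁ false) e₂ false) eo false) eb false

/-- The configuration with the four edges at `a₃` in the states `c₁, c₂, co, cb` (from the base). -/
def open4 (e₁ e₂ eo eb : E) (c₁ c₂ co cb : Bool) (ω : Config E) : Config E :=
  Function.update (Function.update (Function.update (Function.update (base4 e₁ e₂ eo eb ω) e₁ c₁) e₂ c₂)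
    eo co) eb cb

/-- The open neighbours of `a₃` in `open4 c₁ c₂ co cb`. -/
def nbr (o a₁ a₂ b : V) (c₁ c₂ co cb : Bool) (u : V) : Prop :=
  (c₁ = true ∧ u = a₁) ∨ (c₂ = true ∧ u = a₂) ∨ (co = true ∧ u = o) ∨ (cb = true ∧ u = b)

/-- `base4 ω` has the four edges closed. -/
lemma base4_e1 (h : IsMarkedStarAt ends o a₁ a₂ b a₃ e₁ e₂ eo eb) (ω : Config E) :
    base4 e₁ e₂ eo eb ω e₁ = false := by
  simp [base4, Function.update_of_ne h.ne_1b, Function.update_of_ne h.ne_1o, Function.update_of_ne h.ne_12]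

/-- `base4 ω` has the four edges closed. -/
lemma base4_e2 (h : IsMarkedStarAt ends o a₁ a₂ b a₃ e₁ e₂ eo eb) (ω : Config E) :
    base4 e₁ e₂ eo eb ω e₂ = false := by
  simp [base4, Function.update_of_ne h.ne_2b, Function.update_of_ne h.ne_2o]

/-- `base4 ω` has the four edges closed. -/
lemma base4_eo (h : IsMarkedStarAt ends o a₁ a₂ b a₃ e₁ e₂ eo eb) (ω : Config E) :
    base4 e₁ e₂ eo eb ω eo = false := by
  simp [base4, Function.update_of_ne h.ne_ob]

/-- `base4 ω` has the four edges closed. -/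
lemma base4_eb (ω : Config E) : base4 e₁ e₂ eo eb ω eb = false := by simp [base4]

omit [DecidableEq E] in
/-- With every edge at `a₃` closed, `a₃` is isolated. -/
lemma isolated_of_closed4 (h : IsMarkedStarAt ends o a₁ a₂ b a₃ e₁ e₂ eo eb) {ω : Config E}
    (h1 : ω e₁ = false) (h2 : ω e₂ = false) (ho : ω eo = false) (hb : ω eb = false) {x : V}
    (hx : Conn ends ω a₃ x) : x = a₃ := by
  have hS : ∀ y ∈ ({a₃} : Set V), ∀ z, (openGraph ends ω).Adj y z → z ∈ ({a₃} : Set V) := by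
    intro y hy z hyz
    rw [Set.mem_singleton_iff] at hy
    rw [hy] at hyz
    obtain ⟨_, e, he, hends⟩ := openGraph_adj.1 hyz
    have h3 : a₃ ∈ ends e := by rw [hends]; exact Sym2.mem_mk_left _ _
    rcases h.unique e h3 with rfl | rfl | rfl | rfl
    · rw [h1] at he; exact Bool.noConfusion he
    · rw [h2] at he; exact Bool.noConfusion he
    · rw [ho] at he; exact Bool.noConfusion he
    · rw [hb] at he; exact Bool.noConfusion he
  exact mem_of_conn_of_closed hS (Set.mem_singleton a₃) hx

/-- In the base, nothing but `a₃` is joined to `a₃`. -/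
lemma not_conn_base4 (h : IsMarkedStarAt ends o a₁ a₂ b a₃ e₁ e₂ eo eb) (ω : Config E) {x : V}
    (hx : x ≠ a₃) : ¬ Conn ends (base4 e₁ e₂ eo eb ω) x a₃ :=
  fun hc => hx (isolated_of_closed4 h (base4_e1 h ω) (base4_e2 h ω) (base4_eo h ω) (base4_eb ω)
    (conn_symm hc))

omit [DecidableEq E] in
/-- **The bridge invariant.** `BridgeInv ω₀ ω' P`: in `ω'`, the connections among vertices `≠ a₃` are
those of `ω₀` or pass through `a₃` via two neighbours in `P`, and `x ↔ a₃` iff `x ↔ u` in `ω₀` for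
some `u ∈ P`. -/
def BridgeInv (ends : E → Sym2 V) (a₃ : V) (ω₀ ω' : Config E) (P : V → Prop) : Prop :=
  (∀ x y, x ≠ a₃ → y ≠ a₃ → (Conn ends ω' x y ↔ Conn ends ω₀ x y ∨
      ∃ u v, P u ∧ P v ∧ Conn ends ω₀ x u ∧ Conn ends ω₀ v y)) ∧
    (∀ x, x ≠ a₃ → (Conn ends ω' x a₃ ↔ ∃ u, P u ∧ Conn ends ω₀ x u))

/-- The invariant holds in the base with no neighbour. -/
lemma bridgeInv_base (h : IsMarkedStarAt ends o a₁ a₂ b a₃ e₁ e₂ eo eb) (ω : Config E) :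
    BridgeInv ends a₃ (base4 e₁ e₂ eo eb ω) (base4 e₁ e₂ eo eb ω) (fun _ => False) := by
  refine ⟨fun x y _ _ => ?_, fun x hx => ?_⟩
  · constructor
    · exact fun hc => Or.inl hc
    · rintro (hc | ⟨u, v, hu, _, _, _⟩)
      · exact hc
      · exact hu.elim
  · constructor
    · exact fun hc => absurd hc (not_conn_base4 h ω hx)
    · rintro ⟨u, hu, _⟩
      exact hu.elim

/-- **The bridge step**: opening one more edge `e = {u, a₃}` (`u ≠ a₃`, `u` not already… any `u`)
extends the invariant from `P` to `P ∨ (· = u)`. -/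
lemma bridgeInv_step {ω₀ ω' : Config E} {P : V → Prop} {e : E} {u : V}
    (hends : ends e = s(u, a₃)) (hu : u ≠ a₃) (hinv : BridgeInv ends a₃ ω₀ ω' P) :
    BridgeInv ends a₃ ω₀ (Function.update ω' e true) (fun w => P w ∨ w = u) := by
  obtain ⟨hpair, ha3⟩ := hinv
  have hsymm : ∀ y, y ≠ a₃ → (Conn ends ω' a₃ y ↔ ∃ v, P v ∧ Conn ends ω₀ v y) := by
    intro y hy
    rw [conn_comm_iff, ha3 y hy]
    constructor
    · rintro ⟨v, hv, hc⟩; exact ⟨v, hv, conn_symm hc⟩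
    · rintro ⟨v, hv, hc⟩; exact ⟨v, hv, conn_symm hc⟩
  refine ⟨fun x y hx hy => ?_, fun x hx => ?_⟩
  · rw [OneEdge.conn_update_true_iff hends ω' x y, hpair x y hx hy, hpair x u hx hu, hsymm y hy,
      ha3 x hx, hpair u y hu hy]
    constructor
    · rintro ((hc | ⟨u', v', hu', hv', hxu', hv'y⟩) | ⟨(hxu | ⟨u', v', hu', _, hxu', _⟩), v, hv, hvy⟩ |
        ⟨⟨u', hu', hxu'⟩, (huy | ⟨u'', v', _, hv', _, hv'y⟩)⟩)
      · exact Or.inl hc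
      · exact Or.inr ⟨u', v', Or.inl hu', Or.inl hv', hxu', hv'y⟩
      · exact Or.inr ⟨u, v, Or.inr rfl, Or.inl hv, hxu, hvy⟩
      · exact Or.inr ⟨u', v, Or.inl hu', Or.inl hv, hxu', hvy⟩
      · exact Or.inr ⟨u', u, Or.inl hu', Or.inr rfl, hxu', huy⟩
      · exact Or.inr ⟨u', v', Or.inl hu', Or.inl hv', hxu', hv'y⟩
    · rintro (hc | ⟨u', v', (hu' | rfl), (hv' | rfl), hxu', hv'y⟩)
      · exact Or.inl (Or.inl hc)
      · exact Or.inl (Or.inr ⟨u', v', hu', hv', hxu', hv'y⟩)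
      · exact Or.inr (Or.inr ⟨⟨u', hu', hxu'⟩, Or.inl hv'y⟩)
      · exact Or.inr (Or.inl ⟨Or.inl hxu', v', hv', hv'y⟩)
      · exact Or.inl (Or.inl (conn_trans hxu' hv'y))
  · rw [OneEdge.conn_update_true_iff hends ω' x a₃, ha3 x hx, hpair x u hx hu]
    constructor
    · rintro (⟨u', hu', hxu'⟩ | ⟨(hxu | ⟨u', v', hu', _, hxu', _⟩), _⟩ | ⟨⟨u', hu', hxu'⟩, _⟩)
      · exact ⟨u', Or.inl hu', hxu'⟩
      · exact ⟨u, Or.inr rfl, hxu⟩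
      · exact ⟨u', Or.inl hu', hxu'⟩
      · exact ⟨u', Or.inl hu', hxu'⟩
    · rintro ⟨u', (hu' | rfl), hxu'⟩
      · exact Or.inl ⟨u', hu', hxu'⟩
      · exact Or.inr (Or.inl ⟨Or.inl hxu', conn_refl _ _ _⟩)

/-- A closed flag changes nothing: `Function.update ω' e false = ω'` when `ω' e = false`. -/
lemma bridgeInv_flag {ω₀ ω' : Config E} {P : V → Prop} {e : E} {u : V}
    (hends : ends e = s(u, a₃)) (hu : u ≠ a₃) (hinv : BridgeInv ends a₃ ω₀ ω' P) (c : Bool)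
    (hclosed : ω' e = false) :
    BridgeInv ends a₃ ω₀ (Function.update ω' e c) (fun w => P w ∨ (c = true ∧ w = u)) := by
  cases c
  · have e0 : Function.update ω' e false = ω' := by
      rw [← hclosed]; exact Function.update_eq_self e ω'
    rw [e0]
    simp only [Bool.false_eq_true, false_and, or_false]
    exact hinv
  · simp only [true_and]
    exact bridgeInv_step hends hu hinv

omit [DecidableEq E] in
/-- The invariant transports along a propositional equivalence of the neighbour predicate. -/
lemma bridgeInv_congr {ω₀ ω' : Config E} {P P' : V → Prop} (hPP : ∀ w, P w ↔ P' w)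
    (hinv : BridgeInv ends a₃ ω₀ ω' P) : BridgeInv ends a₃ ω₀ ω' P' := by
  obtain ⟨hpair, ha3⟩ := hinv
  refine ⟨fun x y hx hy => ?_, fun x hx => ?_⟩
  · rw [hpair x y hx hy]
    simp only [hPP]
  · rw [ha3 x hx]
    simp only [hPP]

/-- **`a₃` bridges its open neighbours** (the invariant for `open4`). -/
theorem bridgeInv_open4 (h : IsMarkedStarAt ends o a₁ a₂ b a₃ e₁ e₂ eo eb) (ω : Config E)
    (c₁ c₂ co cb : Bool) :
    BridgeInv ends a₃ (base4 e₁ e₂ eo eb ω) (open4 e₁ e₂ eo eb c₁ c₂ co cb ω)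
      (nbr o a₁ a₂ b c₁ c₂ co cb) := by
  have s0 := bridgeInv_base h ω
  have s1 := bridgeInv_flag h.ends_1 h.ne_a1 s0 c₁ (base4_e1 h ω)
  have s2 := bridgeInv_flag h.ends_2 h.ne_a2 s1 c₂
    (by rw [Function.update_of_ne h.ne_12.symm]; exact base4_e2 h ω)
  have s3 := bridgeInv_flag h.ends_o h.ne_o s2 co
    (by rw [Function.update_of_ne h.ne_2o.symm, Function.update_of_ne h.ne_1o.symm]; exact base4_eo h ω)
  have s4 := bridgeInv_flag h.ends_b h.ne_b s3 cb
    (by rw [Function.update_of_ne h.ne_ob.symm, Function.update_of_ne h.ne_2b.symm,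
      Function.update_of_ne h.ne_1b.symm]; exact base4_eb ω)
  refine bridgeInv_congr (fun w => ?_) s4
  unfold nbr
  tauto

/-- **Connections among vertices `≠ a₃`** in `open4`: in the base, or through `a₃` via two open
neighbours. -/
theorem conn_open4_iff (h : IsMarkedStarAt ends o a₁ a₂ b a₃ e₁ e₂ eo eb) (ω : Config E)
    (c₁ c₂ co cb : Bool) {x y : V} (hx : x ≠ a₃) (hy : y ≠ a₃) :
    Conn ends (open4 e₁ e₂ eo eb c₁ c₂ co cb ω) x y ↔
      Conn ends (base4 e₁ e₂ eo eb ω) x y ∨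
        ∃ u v, nbr o a₁ a₂ b c₁ c₂ co cb u ∧ nbr o a₁ a₂ b c₁ c₂ co cb v ∧
          Conn ends (base4 e₁ e₂ eo eb ω) x u ∧ Conn ends (base4 e₁ e₂ eo eb ω) v y :=
  (bridgeInv_open4 h ω c₁ c₂ co cb).1 x y hx hy

/-- **Connections to `a₃`** in `open4`: `x ↔ a₃` iff `x ↔ u` in the base for an open neighbour `u`. -/
theorem conn_open4_a3_iff (h : IsMarkedStarAt ends o a₁ a₂ b a₃ e₁ e₂ eo eb) (ω : Config E)
    (c₁ c₂ co cb : Bool) {x : V} (hx : x ≠ a₃) :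
    Conn ends (open4 e₁ e₂ eo eb c₁ c₂ co cb ω) x a₃ ↔
      ∃ u, nbr o a₁ a₂ b c₁ c₂ co cb u ∧ Conn ends (base4 e₁ e₂ eo eb ω) x u :=
  (bridgeInv_open4 h ω c₁ c₂ co cb).2 x hx

end Star

end CaseOne

end Summit.Ventures.PercRepro2
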